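import Mathlib
import HarnessLib
import Summits.CriticalPhenomena.PercolationContinuityZ3.Theses.PercTorusSliceFilling
import Literature.Probability.Percolation.ConstrainedClusters
import Literature.Probability.Percolation.SubgraphMonotonicity

/-!
# Route `PercTorusSliceFilling`, item `SliceFillingTransport`: the box chart (helper file)

Helper file for item `stmt-CriticalPhenomena-5417` (`SliceFillingTransport`, Lemma E of the card
`torus-slice-filling-identity-v2`, box form) of route `CriticalPhenomena/PercTorusSliceFilling`:

`E_{T_n,p}[N_sf] ≤ n³ · E_{ℤ³,p}[ 1{0 ↔ ∂^{in}B(m) in B(m)} / |C^{B(m)}(0)| ]`, `m = ⌊(n-2)/2⌋`.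

This file contains the STATIC COUPLING behind the inequality. For a torus vertex `x ∈ T_n`
(`torusGraph 3 n`) the chart `a ↦ x + proj a` maps the box `B(m) = [-m, m]³ ⊂ ℤ³` (`box 3 m`,
used as the vertex type `↥(box 3 m : Set (Site 3))`) onto the projected box around `x`; when
`2m + 2 ≤ n` it is injective and a GRAPH ISOMORPHISM between the subgraph of `ℤ³` induced on
`B(m)` and the subgraph of the torus induced on its image (`chart_adj_iff`, `comap_chart_eq`).
Consequently restricting a torus configuration along the chart and restricting a `ℤ³`
configuration to the box (`restrictConfig`, `SubgraphMonotonicity.lean`) have the SAME LAW,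
Bernoulli(`p`) on the edges of the box graph (`map_restrictConfig_chart_eq`, from
`bondPercolation_map_comap`). Finally the integrand of `ThinClusterRarity` —
`1{0 ↔ ∂^{in}B(m) in B(m)} / |C^{B(m)}(0)|` — is a function of the restricted configuration
`η` (`integrand_eq_local`, via `induce_openGraph_eq`), namely the LOCAL FUNCTIONAL
`1{Arm_m(η)} / |Cloc_m(η)|` with the local cluster
`Cloc_m(η) = {y | ∃ h0 hy, (openGraph η).Reachable ⟨0, h0⟩ ⟨y, hy⟩}` and the local arm event
`Arm_m = {η | ∃ y ∈ ∂^{in}B(m), ∃ h0 hy, (openGraph η).Reachable ⟨0, h0⟩ ⟨y, hy⟩}` (both written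
out in full in every statement; no definitions are introduced).
-/

noncomputable section

namespace Summit.CriticalPhenomena.PercolationContinuityZ3.Theorems

open MeasureTheory
open Literature.Probability.Percolation Literature.Probability.LatticeModels

namespace SliceFillingTransportProof

/-! ## Small integers modulo `n` -/

/-- An integer of absolute value `< n` which vanishes modulo `n` is zero. -/
theorem int_eq_zero_of_cast_zmod_eq_zero {n : ℕ} {k : ℤ} (hk : |k| < n)
    (h : (k : ZMod n) = 0) : k = 0 :=
  Int.eq_zero_of_abs_lt_dvd ((ZMod.intCast_zmod_eq_zero_iff_dvd k n).1 h) hk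

/-- `1 ≠ 0` in `ZMod n` for `2 ≤ n` (no `Fact` instance needed). -/
theorem one_ne_zero_zmod {n : ℕ} (hn : 2 ≤ n) : (1 : ZMod n) ≠ 0 := by
  intro h
  have h1 : ((1 : ℤ) : ZMod n) = 0 := by exact_mod_cast h
  have := int_eq_zero_of_cast_zmod_eq_zero (n := n) (k := 1)
    (by rw [abs_one]; exact_mod_cast lt_of_lt_of_le one_lt_two hn) h1
  exact one_ne_zero this

/-! ## The chart `a ↦ x + proj a` on the box `B(m)` -/

/-- `Torus.proj` is additive (on `ℤ³`). -/
theorem proj_add_site3 (n : ℕ) (a b : Site 3) :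
    Torus.proj n (a + b) = Torus.proj n a + Torus.proj n b := by
  ext i; simp [Torus.proj_apply]

/-- `Torus.proj` of a unit coordinate vector is the unit coordinate vector. -/
theorem proj_single (n : ℕ) (i : Fin 3) :
    Torus.proj n (Pi.single i (1 : ℤ) : Site 3) = (Pi.single i (1 : ZMod n) : TorusSite 3 n) := by
  ext j
  rcases eq_or_ne j i with rfl | hj
  · simp [Torus.proj_apply]
  · simp [Torus.proj_apply, Pi.single_eq_of_ne hj]

/-- Coordinates of points of the box are bounded by `m` in absolute value. -/
theorem abs_le_of_mem_box {m : ℕ} {a : Site 3} (ha : a ∈ (box 3 m : Set (Site 3))) (i : Fin 3) :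
    |a i| ≤ m := by
  rw [Finset.mem_coe, mem_box] at ha
  exact abs_le.2 (ha i)

/-- `0 ∈ B(m)`. -/
theorem zero_mem_boxSet (m : ℕ) : (0 : Site 3) ∈ (box 3 m : Set (Site 3)) := by
  rw [Finset.mem_coe]; exact zero_mem_box 3 m

/-- Two points of `B(m)` with the same projection modulo `n > 2m` coincide. -/
theorem eq_of_proj_eq {n m : ℕ} (hn : 2 * m + 1 ≤ n) {a b : Site 3}
    (ha : a ∈ (box 3 m : Set (Site 3))) (hb : b ∈ (box 3 m : Set (Site 3)))
    (h : Torus.proj n a = Torus.proj n b) : a = b := by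
  funext j
  have hj : ((a j - b j : ℤ) : ZMod n) = 0 := by
    have := congr_fun h j
    simp only [Torus.proj_apply] at this
    rw [Int.cast_sub, this, sub_self]
  have habs : |a j - b j| < n := by
    have h1 := abs_le_of_mem_box ha j
    have h2 := abs_le_of_mem_box hb j
    have h3 : |a j - b j| ≤ |a j| + |b j| := abs_sub _ _
    have : (2 * m + 1 : ℤ) ≤ n := by exact_mod_cast hn
    linarith
  have := int_eq_zero_of_cast_zmod_eq_zero habs hj
  linarith

/-- The chart `a ↦ x + proj a` is injective on the box (`2m + 1 ≤ n`). -/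
theorem chart_injective {n m : ℕ} (hn : 2 * m + 1 ≤ n) (x : TorusSite 3 n) :
    Function.Injective (fun a : (box 3 m : Set (Site 3)) => x + Torus.proj n (a : Site 3)) := by
  intro a b h
  apply Subtype.ext
  exact eq_of_proj_eq hn a.2 b.2 (add_left_cancel h)

/-- If `proj b = proj a + eᵢ` for `a, b ∈ B(m)` and `2m + 2 ≤ n`, then `b = a + eᵢ` in `ℤ³`. -/
theorem eq_add_single_of_proj {n m : ℕ} (hn : 2 * m + 2 ≤ n) {a b : Site 3}
    (ha : a ∈ (box 3 m : Set (Site 3))) (hb : b ∈ (box 3 m : Set (Site 3))) (i : Fin 3)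
    (h : Torus.proj n b = Torus.proj n a + (Pi.single i (1 : ZMod n) : TorusSite 3 n)) :
    b = a + Pi.single i (1 : ℤ) := by
  funext j
  have hj : ((b j - a j - (Pi.single i (1 : ℤ) : Site 3) j : ℤ) : ZMod n) = 0 := by
    have := congr_fun h j
    simp only [Torus.proj_apply, Pi.add_apply] at this
    have hs : (((Pi.single i (1 : ℤ) : Site 3) j : ℤ) : ZMod n) =
        (Pi.single i (1 : ZMod n) : TorusSite 3 n) j := by
      have := congr_fun (proj_single n i) j
      simpa only [Torus.proj_apply] using this
    rw [Int.cast_sub, Int.cast_sub, hs, this]; ring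
  have hsingle : |(Pi.single i (1 : ℤ) : Site 3) j| ≤ 1 := by
    rcases eq_or_ne j i with rfl | hji
    · simp
    · simp [Pi.single_eq_of_ne hji]
  have habs : |b j - a j - (Pi.single i (1 : ℤ) : Site 3) j| < n := by
    have h1 := abs_le_of_mem_box ha j
    have h2 := abs_le_of_mem_box hb j
    have h3 : |b j - a j - (Pi.single i (1 : ℤ) : Site 3) j| ≤
        |b j| + |a j| + |(Pi.single i (1 : ℤ) : Site 3) j| := by
      refine (abs_sub _ _).trans ?_
      gcongr
      exact abs_sub _ _
    have : (2 * m + 2 : ℤ) ≤ n := by exact_mod_cast hn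
    linarith
  have := int_eq_zero_of_cast_zmod_eq_zero habs hj
  rw [Pi.add_apply]
  linarith

/-- **Local isomorphism.** For `a, b ∈ B(m)` and `2m + 2 ≤ n`: `x + proj a ∼ x + proj b` in the
torus `T_n` iff `a ∼ b` in `ℤ³`. -/
theorem chart_adj_iff {n m : ℕ} (hn : 2 * m + 2 ≤ n) (x : TorusSite 3 n)
    (a b : (box 3 m : Set (Site 3))) :
    (torusGraph 3 n).Adj (x + Torus.proj n (a : Site 3)) (x + Torus.proj n (b : Site 3)) ↔
      (zdGraph 3).Adj (a : Site 3) b := by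
  rw [torusGraph_adj_iff, zdGraph_adj_iff]
  constructor
  · rintro ⟨-, h | h⟩
    · obtain ⟨i, hi⟩ := h
      refine ⟨i, Or.inl (eq_add_single_of_proj hn a.2 b.2 i ?_)⟩
      rw [add_assoc] at hi
      exact add_left_cancel hi
    · obtain ⟨i, hi⟩ := h
      refine ⟨i, Or.inr (eq_add_single_of_proj hn b.2 a.2 i ?_)⟩
      rw [add_assoc] at hi
      exact add_left_cancel hi
  · rintro ⟨i, h | h⟩
    · have hb : Torus.proj n (b : Site 3) = Torus.proj n a + Pi.single i 1 := by
        rw [h, proj_add_site3, proj_single]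
      refine ⟨?_, Or.inl ⟨i, by rw [hb, add_assoc]⟩⟩
      intro heq
      have h1 := add_left_cancel heq
      rw [hb] at h1
      have h2 : (Pi.single i (1 : ZMod n) : TorusSite 3 n) = 0 := by
        have := congrArg (fun z => z - Torus.proj n (a : Site 3)) h1
        simpa using this.symm
      have h3 := congr_fun h2 i
      simp only [Pi.single_eq_same, Pi.zero_apply] at h3
      exact one_ne_zero_zmod (by omega) h3
    · have ha : Torus.proj n (a : Site 3) = Torus.proj n b + Pi.single i 1 := by
        rw [h, proj_add_site3, proj_single]
      refine ⟨?_, Or.inr ⟨i, by rw [ha, add_assoc]⟩⟩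
      intro heq
      have h1 := add_left_cancel heq
      rw [ha] at h1
      have h2 : (Pi.single i (1 : ZMod n) : TorusSite 3 n) = 0 := by
        have := congrArg (fun z => z - Torus.proj n (b : Site 3)) h1
        simpa using this
      have h3 := congr_fun h2 i
      simp only [Pi.single_eq_same, Pi.zero_apply] at h3
      exact one_ne_zero_zmod (by omega) h3

/-- The box graph: the pull-back of the torus graph along the chart is the pull-back of `ℤ³`
along the inclusion of the box. -/
theorem comap_chart_eq {n m : ℕ} (hn : 2 * m + 2 ≤ n) (x : TorusSite 3 n) :
    (torusGraph 3 n).comap (fun a : (box 3 m : Set (Site 3)) => x + Torus.proj n (a : Site 3)) =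
      (zdGraph 3).comap (Subtype.val : (box 3 m : Set (Site 3)) → Site 3) := by
  ext a b
  simp only [SimpleGraph.comap_adj]
  exact chart_adj_iff hn x a b

/-- **Same local law.** Restricting a torus configuration along the chart and restricting a
`ℤ³` configuration to the box give the same law (Bernoulli(`p`) on the edges of the box graph;
`bondPercolation_map_comap`). -/
theorem map_restrictConfig_chart_eq {n m : ℕ} (hn : 2 * m + 2 ≤ n) (x : TorusSite 3 n)
    (p : unitInterval) :
    (bondPercolation (torusGraph 3 n) p).map
        (restrictConfig (fun a : (box 3 m : Set (Site 3)) => x + Torus.proj n (a : Site 3))) =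
      (bondPercolation (zdGraph 3) p).map
        (restrictConfig (Subtype.val : (box 3 m : Set (Site 3)) → Site 3)) := by
  rw [bondPercolation_map_comap _ (chart_injective (by omega) x),
    bondPercolation_map_comap _ Subtype.val_injective, comap_chart_eq hn]

/-! ## Locality of the `ℤ³` integrand -/

/-- **The `ℤ³` integrand is local.** The integrand `1{0 ↔ ∂^{in}B(m) in B(m)} / |C^{B(m)}(0)|` of
`ThinClusterRarity` equals the local functional `1{Arm_m(η)} / |Cloc_m(η)|` of the configuration
`η` restricted to the box (the induced open graph on the box is the open graph of the restricted
configuration, `induce_openGraph_eq`). -/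
theorem integrand_eq_local (m : ℕ) (ω : BondConfig (Site 3)) :
    (siteToBoundary 3 m).indicator
        (fun ω => ((Set.ncard {y : Site 3 | ω ∈ openConnIn (↑(box 3 m)) 0 y} : ℝ))⁻¹) ω =
      {η : BondConfig (box 3 m : Set (Site 3)) | ∃ y ∈ innerBoundary (zdGraph 3) (box 3 m),
          ∃ (h0 : (0 : Site 3) ∈ (box 3 m : Set (Site 3))) (hy : y ∈ (box 3 m : Set (Site 3))),
            (openGraph η).Reachable ⟨0, h0⟩ ⟨y, hy⟩}.indicator
        (fun η => ((Set.ncard {y : Site 3 | ∃ (h0 : (0 : Site 3) ∈ (box 3 m : Set (Site 3)))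
          (hy : y ∈ (box 3 m : Set (Site 3))), (openGraph η).Reachable ⟨0, h0⟩ ⟨y, hy⟩} : ℝ))⁻¹)
        (restrictConfig (Subtype.val : (box 3 m : Set (Site 3)) → Site 3) ω) := by
  have hmem : ω ∈ siteToBoundary 3 m ↔
      restrictConfig (Subtype.val : (box 3 m : Set (Site 3)) → Site 3) ω ∈
        {η : BondConfig (box 3 m : Set (Site 3)) | ∃ y ∈ innerBoundary (zdGraph 3) (box 3 m),
          ∃ (h0 : (0 : Site 3) ∈ (box 3 m : Set (Site 3))) (hy : y ∈ (box 3 m : Set (Site 3))),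
            (openGraph η).Reachable ⟨0, h0⟩ ⟨y, hy⟩} := by
    simp only [siteToBoundary, openConnIn, Set.mem_setOf_eq, induce_openGraph_eq]
  have hcl : {y : Site 3 | ω ∈ openConnIn (↑(box 3 m)) 0 y} =
      {y : Site 3 | ∃ (h0 : (0 : Site 3) ∈ (box 3 m : Set (Site 3)))
        (hy : y ∈ (box 3 m : Set (Site 3))),
          (openGraph (restrictConfig (Subtype.val : (box 3 m : Set (Site 3)) → Site 3) ω)).Reachable
            ⟨0, h0⟩ ⟨y, hy⟩} := by
    ext y
    simp only [openConnIn, Set.mem_setOf_eq, induce_openGraph_eq]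
  by_cases h : ω ∈ siteToBoundary 3 m
  · rw [Set.indicator_of_mem h, Set.indicator_of_mem (hmem.1 h), hcl]
  · rw [Set.indicator_of_notMem h, Set.indicator_of_notMem (mt hmem.2 h)]

end SliceFillingTransportProof

end Summit.CriticalPhenomena.PercolationContinuityZ3.Theorems
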